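import Literature.Geometry.Lorentzian.KerrSchildDivergence

/-!
# Route EIHFluxBalance — `InertialRecession` (E′), stub `stub_slaving` (K1): Kerr–Schild data and
# first derivatives at rest-frame AXIS points

Helper file for the crux `stmt-FinalStateConjecture-17403` (evidence notes `K1_linear_architecture.md`,
`K1_seat1_claims.md`). At a point `y = (t, 0, 0, z)` of the symmetry axis, `z ≠ 0`, every spin `a`:
`r = |z|`, `Σ = z² + a²`, `H = M|z|/(z² + a²)`, `ℓ = (1, 0, 0, ε)` (`ε = z/|z|`), and the first
derivatives are `∂₁r = ∂₂r = 0`, `∂₃r = ε`; `∂₁ℓ = (0, α, −β, 0)`, `∂₂ℓ = (0, β, α, 0)`,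
`∂₃ℓ = ∂₀ℓ = 0` with `α = |z|/(z² + a²)`, `β = a/(z² + a²)`; `∂₀H = ∂₁H = ∂₂H = 0`,
`∂₃H = Mε(a² − z²)/(z² + a²)²`. These are the inputs of the kernel lemma at three axis points for the
first-variation map of the painted Kerr–Schild summand (`…SlavingAxisKernel`). Literature only
(`KerrSchildDivergence`: `fderiv_radius_basisVector_*`, `fderiv_nullCovectorFun_*`,
`hasDerivAt_radius_line`); no definitions, no `sorry`. [folklore]
-/

set_option linter.dupNamespace false

noncomputable section

open scoped Topology
open Filter Set Function Literature.Geometry.Lorentzian Literature.Geometry.Lorentzian.Kerr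

namespace Summit.FinalStateConjecture.FinalStateConjecture.Theorems.SublinearIsFree.Slaving

section Axis

variable {a : ℝ} {y : E4} (h1 : y 1 = 0) (h2 : y 2 = 0)
include h1 h2

/-- On the axis `ρ² = z²`. [folklore] -/
theorem axis_spatialNorm_sq : E4.spatialNorm y ^ 2 = y 3 ^ 2 := by
  rw [E4.spatialNorm_sq, h1, h2]; ring

/-- On the axis the discriminant is a perfect square: `(z² − a²)² + 4a²z² = (z² + a²)²`. [folklore] -/
theorem axis_radiusDiscr : radiusDiscr a y = (y 3 ^ 2 + a ^ 2) ^ 2 := by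
  unfold radiusDiscr; rw [axis_spatialNorm_sq h1 h2]; ring

/-- **On the axis `r = |z|`** (Visser arXiv:0706.0622, (35)). [folklore] -/
theorem axis_radius : radius a y = |y 3| := by
  rw [radius_eq, axis_radiusDiscr h1 h2, axis_spatialNorm_sq h1 h2,
    Real.sqrt_sq (by positivity : (0 : ℝ) ≤ y 3 ^ 2 + a ^ 2)]
  rw [show (y 3 ^ 2 - a ^ 2 + (y 3 ^ 2 + a ^ 2)) / 2 = y 3 ^ 2 by ring, Real.sqrt_sq_eq_abs]

/-- `r² + a² = z² + a²` on the axis. [folklore] -/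
theorem axis_radius_sq_add : radius a y ^ 2 + a ^ 2 = y 3 ^ 2 + a ^ 2 := by
  rw [axis_radius h1 h2, sq_abs]

/-- On the axis off the origin `r > 0`. [folklore] -/
theorem axis_radius_pos (hz : y 3 ≠ 0) : 0 < radius a y := by
  rw [axis_radius h1 h2]; exact abs_pos.2 hz

/-- `Σ = z² + a²` on the axis. [folklore] -/
theorem axis_blSigma : blSigma a (E4.spatial y) = y 3 ^ 2 + a ^ 2 := by
  unfold blSigma
  rw [radius_ofTimeSpace_spatial, axis_radius h1 h2, sq_abs]
  have : ‖E4.spatial y‖ ^ 2 = y 3 ^ 2 := axis_spatialNorm_sq h1 h2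
  rw [this]; ring

end Axis


/-! ### First derivatives of `ℓ` and `H` in an arbitrary direction (quotient rule along lines) -/

section General

variable {a : ℝ} {x : E4} (hx : 0 < radius a x)
include hx

omit hx in
/-- Components of the point `x + t v`. [folklore] -/
theorem add_smul_apply_E4 (x v : E4) (t : ℝ) (j : Fin 4) : (x + t • v) j = x j + t * v j := by
  simp

/-- `∂_v ℓ₁ = ((∂_v r · x¹ + r v¹ + a v²)(r² + a²) − (r x¹ + a x²) · 2r ∂_v r)/(r² + a²)²`
(quotient rule along `t ↦ x + t v`; Visser arXiv:0706.0622, (34)). [folklore] -/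
theorem fderiv_nullCovectorFun_one (v : E4) :
    fderiv ℝ (fun y ↦ nullCovectorFun a y 1) x v =
      ((fderiv ℝ (radius a) x v * x 1 + radius a x * v 1 + a * v 2) * (radius a x ^ 2 + a ^ 2) -
        (radius a x * x 1 + a * x 2) * (2 * radius a x * fderiv ℝ (radius a) x v)) /
      (radius a x ^ 2 + a ^ 2) ^ 2 := by
  have hQ : radius a x ^ 2 + a ^ 2 ≠ 0 := by positivity
  have hd : DifferentiableAt ℝ (fun y ↦ nullCovectorFun a y 1) x :=
    (contDiffAt_nullCovectorFun a hx (n := 1) 1).differentiableAt one_ne_zero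
  refine (hd.hasFDerivAt.hasLineDerivAt v).unique ?_
  show HasDerivAt (fun t : ℝ ↦ nullCovectorFun a (x + t • v) 1) _ 0
  have hr := hasDerivAt_radius_line hx v
  have hnum : HasDerivAt (fun t : ℝ ↦ radius a (x + t • v) * (x 1 + t * v 1) + a * (x 2 + t * v 2))
      (fderiv ℝ (radius a) x v * (x 1 + 0 * v 1) + radius a (x + (0 : ℝ) • v) * (1 * v 1) +
        a * (1 * v 2)) 0 :=
    (hr.mul (((hasDerivAt_id (0 : ℝ)).mul_const (v 1)).const_add (x 1))).add
      ((((hasDerivAt_id (0 : ℝ)).mul_const (v 2)).const_add (x 2)).const_mul a)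
  have hden : HasDerivAt (fun t : ℝ ↦ radius a (x + t • v) ^ 2 + a ^ 2)
      (↑(2 : ℕ) * radius a (x + (0 : ℝ) • v) ^ (2 - 1) * fderiv ℝ (radius a) x v) 0 :=
    (hr.pow 2).add_const (a ^ 2)
  have hdiv := hnum.div hden (by simpa using hQ)
  have hfun : (fun t : ℝ ↦ nullCovectorFun a (x + t • v) 1) = fun t ↦
      (radius a (x + t • v) * (x 1 + t * v 1) + a * (x 2 + t * v 2)) /
        (radius a (x + t • v) ^ 2 + a ^ 2) := by
    funext t; rw [nullCovectorFun_apply_one, add_smul_apply_E4, add_smul_apply_E4]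
  rw [hfun]
  refine hdiv.congr_deriv ?_
  simp only [zero_smul, add_zero, Nat.cast_ofNat, one_mul, zero_mul, pow_one, Nat.add_one_sub_one]

/-- `∂_v ℓ₂ = ((∂_v r · x² + r v² − a v¹)(r² + a²) − (r x² − a x¹) · 2r ∂_v r)/(r² + a²)²`. [folklore] -/
theorem fderiv_nullCovectorFun_two (v : E4) :
    fderiv ℝ (fun y ↦ nullCovectorFun a y 2) x v =
      ((fderiv ℝ (radius a) x v * x 2 + radius a x * v 2 - a * v 1) * (radius a x ^ 2 + a ^ 2) -
        (radius a x * x 2 - a * x 1) * (2 * radius a x * fderiv ℝ (radius a) x v)) /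
      (radius a x ^ 2 + a ^ 2) ^ 2 := by
  have hQ : radius a x ^ 2 + a ^ 2 ≠ 0 := by positivity
  have hd : DifferentiableAt ℝ (fun y ↦ nullCovectorFun a y 2) x :=
    (contDiffAt_nullCovectorFun a hx (n := 1) 2).differentiableAt one_ne_zero
  refine (hd.hasFDerivAt.hasLineDerivAt v).unique ?_
  show HasDerivAt (fun t : ℝ ↦ nullCovectorFun a (x + t • v) 2) _ 0
  have hr := hasDerivAt_radius_line hx v
  have hnum : HasDerivAt (fun t : ℝ ↦ radius a (x + t • v) * (x 2 + t * v 2) - a * (x 1 + t * v 1))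
      (fderiv ℝ (radius a) x v * (x 2 + 0 * v 2) + radius a (x + (0 : ℝ) • v) * (1 * v 2) -
        a * (1 * v 1)) 0 :=
    (hr.mul (((hasDerivAt_id (0 : ℝ)).mul_const (v 2)).const_add (x 2))).sub
      ((((hasDerivAt_id (0 : ℝ)).mul_const (v 1)).const_add (x 1)).const_mul a)
  have hden : HasDerivAt (fun t : ℝ ↦ radius a (x + t • v) ^ 2 + a ^ 2)
      (↑(2 : ℕ) * radius a (x + (0 : ℝ) • v) ^ (2 - 1) * fderiv ℝ (radius a) x v) 0 :=
    (hr.pow 2).add_const (a ^ 2)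
  have hdiv := hnum.div hden (by simpa using hQ)
  have hfun : (fun t : ℝ ↦ nullCovectorFun a (x + t • v) 2) = fun t ↦
      (radius a (x + t • v) * (x 2 + t * v 2) - a * (x 1 + t * v 1)) /
        (radius a (x + t • v) ^ 2 + a ^ 2) := by
    funext t; rw [nullCovectorFun_apply_two, add_smul_apply_E4, add_smul_apply_E4]
  rw [hfun]
  refine hdiv.congr_deriv ?_
  simp only [zero_smul, add_zero, Nat.cast_ofNat, one_mul, zero_mul, pow_one, Nat.add_one_sub_one]

/-- `∂_v ℓ₃ = (v³ r − x³ ∂_v r)/r²`. [folklore] -/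
theorem fderiv_nullCovectorFun_three (v : E4) :
    fderiv ℝ (fun y ↦ nullCovectorFun a y 3) x v =
      (v 3 * radius a x - x 3 * fderiv ℝ (radius a) x v) / radius a x ^ 2 := by
  have hd : DifferentiableAt ℝ (fun y ↦ nullCovectorFun a y 3) x :=
    (contDiffAt_nullCovectorFun a hx (n := 1) 3).differentiableAt one_ne_zero
  refine (hd.hasFDerivAt.hasLineDerivAt v).unique ?_
  show HasDerivAt (fun t : ℝ ↦ nullCovectorFun a (x + t • v) 3) _ 0
  have hr := hasDerivAt_radius_line hx v
  have hnum : HasDerivAt (fun t : ℝ ↦ x 3 + t * v 3) (1 * v 3) 0 :=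
    ((hasDerivAt_id (0 : ℝ)).mul_const (v 3)).const_add (x 3)
  have hdiv := hnum.div hr (by simpa using hx.ne')
  have hfun : (fun t : ℝ ↦ nullCovectorFun a (x + t • v) 3) = fun t ↦
      (x 3 + t * v 3) / radius a (x + t • v) := by
    funext t; rw [nullCovectorFun_apply_three, add_smul_apply_E4]
  rw [hfun]
  refine hdiv.congr_deriv ?_
  simp only [zero_smul, add_zero, one_mul, zero_mul]

/-- `∂_v H = M (3r² ∂_v r (r⁴ + a² z²) − r³ (4r³ ∂_v r + 2a² z v³))/(r⁴ + a² z²)²` for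
`H = M r³/(r⁴ + a² z²)` (Visser arXiv:0706.0622, (33)). [folklore] -/
theorem fderiv_scalarH (M : ℝ) (v : E4) :
    fderiv ℝ (scalarH M a) x v =
      M * (3 * radius a x ^ 2 * fderiv ℝ (radius a) x v * (radius a x ^ 4 + a ^ 2 * x 3 ^ 2) -
        radius a x ^ 3 * (4 * radius a x ^ 3 * fderiv ℝ (radius a) x v + 2 * a ^ 2 * x 3 * v 3)) /
      (radius a x ^ 4 + a ^ 2 * x 3 ^ 2) ^ 2 := by
  have hD : radius a x ^ 4 + a ^ 2 * x 3 ^ 2 ≠ 0 := by positivity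
  have hd : DifferentiableAt ℝ (scalarH M a) x :=
    (contDiffAt_scalarH M a hx (n := 1)).differentiableAt one_ne_zero
  refine (hd.hasFDerivAt.hasLineDerivAt v).unique ?_
  show HasDerivAt (fun t : ℝ ↦ scalarH M a (x + t • v)) _ 0
  have hr := hasDerivAt_radius_line hx v
  have hnum : HasDerivAt (fun t : ℝ ↦ M * radius a (x + t • v) ^ 3)
      (M * (↑(3 : ℕ) * radius a (x + (0 : ℝ) • v) ^ (3 - 1) * fderiv ℝ (radius a) x v)) 0 :=
    (hr.pow 3).const_mul M
  have hden : HasDerivAt (fun t : ℝ ↦ radius a (x + t • v) ^ 4 + a ^ 2 * (x 3 + t * v 3) ^ 2)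
      (↑(4 : ℕ) * radius a (x + (0 : ℝ) • v) ^ (4 - 1) * fderiv ℝ (radius a) x v +
        a ^ 2 * (↑(2 : ℕ) * (x 3 + 0 * v 3) ^ (2 - 1) * (1 * v 3))) 0 :=
    (hr.pow 4).add (((((hasDerivAt_id (0 : ℝ)).mul_const (v 3)).const_add (x 3)).pow 2).const_mul
      (a ^ 2))
  have hdiv := hnum.div hden (by simpa using hD)
  have hfun : (fun t : ℝ ↦ scalarH M a (x + t • v)) = fun t ↦
      M * radius a (x + t • v) ^ 3 / (radius a (x + t • v) ^ 4 + a ^ 2 * (x 3 + t * v 3) ^ 2) := by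
    funext t; unfold scalarH; rw [add_smul_apply_E4]
  rw [hfun]
  refine hdiv.congr_deriv ?_
  simp only [zero_smul, add_zero, Nat.cast_ofNat, one_mul, zero_mul]
  norm_num
  ring

end General


/-! ### The table of values and first derivatives at an axis point -/

section AxisTable

variable {M a : ℝ} {y : E4} (h1 : y 1 = 0) (h2 : y 2 = 0) (hz : y 3 ≠ 0)
include h1 h2

/-- `ℓ = (1, 0, 0, z/|z|)` on the axis. [folklore] -/
theorem axis_nullCovectorFun :
    nullCovectorFun a y = ![1, 0, 0, y 3 / |y 3|] := by
  have hr := axis_radius (a := a) h1 h2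
  funext μ
  fin_cases μ
  · simp [nullCovectorFun]
  · simp [nullCovectorFun_apply_one, h1, h2]
  · simp [nullCovectorFun_apply_two, h1, h2]
  · simp [nullCovectorFun_apply_three, hr]

include hz

/-- `H = M|z|/(z² + a²)` on the axis. [folklore] -/
theorem axis_scalarH : scalarH M a y = M * |y 3| / (y 3 ^ 2 + a ^ 2) := by
  unfold scalarH
  rw [axis_radius h1 h2]
  have hz0 : 0 < |y 3| := abs_pos.2 hz
  have hab : |y 3| ^ 2 = y 3 ^ 2 := sq_abs _
  have hD : y 3 ^ 2 + a ^ 2 ≠ 0 := by positivity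
  have hD' : |y 3| ^ 4 + a ^ 2 * y 3 ^ 2 ≠ 0 := by positivity
  rw [div_eq_div_iff hD' hD]
  have h4 : |y 3| ^ 4 = y 3 ^ 2 * y 3 ^ 2 := by rw [← hab]; ring
  rw [h4]
  have h3 : |y 3| ^ 3 = |y 3| * y 3 ^ 2 := by rw [← hab]; ring
  rw [h3]; ring

/-- `∂₀ r = ∂₁ r = ∂₂ r = 0`, `∂₃ r = z/|z|` on the axis. [folklore] -/
theorem axis_fderiv_radius (c : Fin 4) :
    fderiv ℝ (radius a) y (E4.basisVector c) = ![0, 0, 0, y 3 / |y 3|] c := by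
  have hx := axis_radius_pos (a := a) h1 h2 hz
  have hr := axis_radius (a := a) h1 h2
  have hz0 : 0 < |y 3| := abs_pos.2 hz
  fin_cases c
  · -- stationarity
    have hd : DifferentiableAt ℝ (radius a) y :=
      (contDiffAt_radius hx (n := 1)).differentiableAt one_ne_zero
    have hl : HasLineDerivAt ℝ (radius a) 0 y (E4.basisVector 0) := by
      show HasDerivAt (fun t : ℝ ↦ radius a (y + t • E4.basisVector 0)) 0 0
      have : (fun t : ℝ ↦ radius a (y + t • E4.basisVector 0)) = fun _ ↦ radius a y :=
        funext fun t ↦ radius_add_time_smul_basisVector a y t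
      rw [this]; exact hasDerivAt_const _ _
    simpa using (hd.hasFDerivAt.hasLineDerivAt (E4.basisVector 0)).unique hl
  · simp [fderiv_radius_basisVector_one hx, h1]
  · simp [fderiv_radius_basisVector_two hx, h2]
  · show fderiv ℝ (radius a) y (E4.basisVector 3) = y 3 / |y 3|
    rw [fderiv_radius_basisVector_three hx, axis_blSigma h1 h2, hr]
    have hD : y 3 ^ 2 + a ^ 2 ≠ 0 := by positivity
    rw [div_eq_div_iff (by positivity) hz0.ne', sq_abs]
    ring

/-- `∂_c ℓ_μ` on the axis: `∂₁ℓ = (0, α, −β, 0)`, `∂₂ℓ = (0, β, α, 0)`, `∂₀ℓ = ∂₃ℓ = 0`,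
`α = |z|/(z² + a²)`, `β = a/(z² + a²)`. [folklore] -/
theorem axis_fderiv_nullCovectorFun (c μ : Fin 4) :
    fderiv ℝ (fun x ↦ nullCovectorFun a x μ) y (E4.basisVector c) =
      ![![0, 0, 0, 0],
        ![0, |y 3| / (y 3 ^ 2 + a ^ 2), -(a / (y 3 ^ 2 + a ^ 2)), 0],
        ![0, a / (y 3 ^ 2 + a ^ 2), |y 3| / (y 3 ^ 2 + a ^ 2), 0],
        ![0, 0, 0, 0]] c μ := by
  have hx := axis_radius_pos (a := a) h1 h2 hz
  have hr := axis_radius (a := a) h1 h2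
  have hdr := axis_fderiv_radius (a := a) h1 h2 hz
  have hz0 : 0 < |y 3| := abs_pos.2 hz
  have hab : |y 3| ^ 2 = y 3 ^ 2 := sq_abs _
  have hD : y 3 ^ 2 + a ^ 2 ≠ 0 := by positivity
  fin_cases μ
  · fin_cases c <;> simp [nullCovectorFun]
  · fin_cases c <;>
      simp [fderiv_nullCovectorFun_one hx, hdr, hr, h1, h2, E4.basisVector, hab] <;>
      field_simp
  · fin_cases c <;>
      simp [fderiv_nullCovectorFun_two hx, hdr, hr, h1, h2, E4.basisVector, hab] <;>
      field_simp
  · have key : y 3 * (y 3 / |y 3|) = |y 3| := by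
      rw [mul_div_assoc', ← sq, ← hab, sq, mul_div_assoc, div_self hz0.ne', mul_one]
    fin_cases c <;> simp [fderiv_nullCovectorFun_three hx, hdr, hr, E4.basisVector, key]

/-- `∂_c H` on the axis: `∂₀H = ∂₁H = ∂₂H = 0`, `∂₃H = M (z/|z|)(a² − z²)/(z² + a²)²`. [folklore] -/
theorem axis_fderiv_scalarH (c : Fin 4) :
    fderiv ℝ (scalarH M a) y (E4.basisVector c) =
      ![0, 0, 0, M * (y 3 / |y 3|) * (a ^ 2 - y 3 ^ 2) / (y 3 ^ 2 + a ^ 2) ^ 2] c := by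
  have hx := axis_radius_pos (a := a) h1 h2 hz
  have hr := axis_radius (a := a) h1 h2
  have hdr := axis_fderiv_radius (a := a) h1 h2 hz
  have hz0 : 0 < |y 3| := abs_pos.2 hz
  have hab : |y 3| ^ 2 = y 3 ^ 2 := sq_abs _
  have hD : y 3 ^ 2 + a ^ 2 ≠ 0 := by positivity
  fin_cases c <;> simp [fderiv_scalarH hx, hdr, hr, E4.basisVector]
  have hD' : |y 3| ^ 4 + a ^ 2 * y 3 ^ 2 ≠ 0 := by positivity
  rw [div_eq_div_iff (pow_ne_zero 2 hD') (pow_ne_zero 2 hD)]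
  have h4 : |y 3| ^ 4 = y 3 ^ 4 := (by decide : Even 4).pow_abs (y 3)
  field_simp
  simp only [h4, hab]
  ring

end AxisTable

/-- Registered carrier `slaving_axisData_slaving12` of the crux item (= `axis_fderiv_scalarH`). [folklore] -/
theorem slaving_axisData_slaving12 : open Literature.Geometry.Lorentzian in ∀ {M a : ℝ} {y : E4}, y 1 = 0 → y 2 = 0 → y 3 ≠ 0 → ∀ c : Fin 4, fderiv ℝ (Kerr.scalarH M a) y (E4.basisVector c) = ![0, 0, 0, M * (y 3 / |y 3|) * (a ^ 2 - y 3 ^ 2) / (y 3 ^ 2 + a ^ 2) ^ 2] c :=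
  fun h1 h2 hz c ↦ axis_fderiv_scalarH h1 h2 hz c

end Summit.FinalStateConjecture.FinalStateConjecture.Theorems.SublinearIsFree.Slaving
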